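import Literature.AlgebraicGeometry.Motives.ZetaFunctionPoleOrderTateConjecture
import Literature.AlgebraicGeometry.Motives.SupersingularAbelianVarietyProofs
import HarnessLib

/-!
# Tate's theorem in codimensions `0` and `dim X`: the unconditional cases, and the simple poles of
# `Z(X, t)` at `t = 1` and `t = q^{-d}` (Kahn 2020 §6.14; Tate 1994 Th. 2.9)

Topic `Literature/AlgebraicGeometry/Motives`; THEOREMS ONLY (no definition, no named fact).

For a Weil cohomology theory with Galois action `E` (`GaloisRealization`) and `X` smooth projective
of dimension `d`, the two extreme degrees are lines spanned by algebraic classes: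
`H⁰(X) = K · 1 = K · γ_X[X]` (`algebraicClasses_zero_eq_top_univ`) and `H^{2d}(X) = K · η^d`
(`algebraicClasses_top_eq_top`, from the tree's `lefschetzClasses_top_eq_top`). The twisted Galois
action is trivial on both (`ρTwist_zero_apply`: algebraic classes are invariant; `ρTwist_top_apply`:
`tr(χ(g)^d g x) = tr x` and the trace is an isomorphism). Consequently — over ANY field `k` — the
tree's Tate conjecture holds in codimensions `0` and `d` (`tateConjectureFor_zero`,
`tateConjectureFor_top`) and the Poincaré pairing has trivial kernels on `A⁰ × A^d`
(`homNum_of_algebraicClasses_eq_top_right/left`); and — over a FINITE field — every statement of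
Tate's theorem 2.9 (rows g37-#2 … #4) holds unconditionally for `r = 0` and `r = d`:
`T_F`, `E`, `S`, `ρ_0 = ρ_d = 1 = dim H⁰(X)(0)_1 = dim H^{2d}(X)(d)_1` (`tate_a_zero`, `tate_a_top`,
`rank_zero_eq_one`, `finrank_maxGenEigenspace_zero/top_eq_one`, …), and, under the trace formula,
`χ(φ) = q` and the Riemann hypothesis for `X`, **`Z(X, t)` has SIMPLE POLES at `t = 1` and at
`t = q^{-d}`** (`hasPoleOfOrderAt_zetaSeries_one`, `hasPoleOfOrderAt_zetaSeries_top`) — Kahn's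
remark that Conjecture 6.52 («`ord_{s=i} ζ(X, s) = -rg A^i_num(X)`») «holds for `i = 0` due to the
"Riemann hypothesis" part of the Weil conjectures», and its mirror `i = d`.

Sources: B. Kahn, *Zeta and L-functions of varieties and motives* (2020) §6.14 p. 132 (Conj. 6.52
and the sentence after it; Th. 6.53); J. Tate, PSPM 55.1 (1994) Th. 2.9 (through Kahn and
J. S. Milne, arXiv:0709.3040 Th. 1.2); S. Kleiman, *Algebraic cycles and the Weil conjectures*
(1968) §1.2 (A), (C) (`H⁰`, `H^{2d}` one-dimensional; `γ_X[X] = 1`; `deg ηᵈ > 0`); P. Deligne,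
*Weil I* (1974) (2.5)(c) (`F = q^d` on `H^{2d}`).

## Provenance

Lane `lit-hodgefound` (summit `HodgeConjecture`, Track 2 foundations library, Layer B: motives),
seat `lit-hodgefound-p29` (literature-prover, generation 37, row g37-#5).
-/

universe u v

open CategoryTheory AlgebraicGeometry Polynomial

noncomputable section

namespace Literature.AlgebraicGeometry.Motives

open Literature.LinearAlgebra Literature.AlgebraicGeometry.Kahn2003

/-! ## §1 The extreme degrees of a Weil cohomology theory -/

namespace WeilCohomology

variable {k : Type u} [Field k] {K : Type v} [Field K] [CharZero K] (W : WeilCohomology k K)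
variable {d : ℕ} {X : SchemeOver k}

/-- **`K · A⁰(X) = H⁰(X)`** for `X` smooth projective: `H⁰(X) = K · 1 = K · γ_X[X]`
(`lefschetzClasses_zero_eq_top`; the tree's `algebraicClasses_zero_eq_top` of `AbstractHodgeTate`
states this for `k : Type`, here in arbitrary universe). [cite: Kleiman1968, §1.2 (A), (C)] -/
theorem algebraicClasses_zero_eq_top_univ (hX : IsSmoothProjective d X) :
    W.algebraicClasses X 0 = ⊤ :=
  eq_top_iff.2 ((W.lefschetzClasses_zero_eq_top hX).ge.trans (W.lefschetzClasses_le_algebraicClasses hX 0))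

/-- **`K · Aᵈ(X) = H^{2d}(X)`** for `X` smooth projective of dimension `d`: the top degree is the line
spanned by the Lefschetz class `ηᵈ` (`lefschetzClasses_top_eq_top`), which is algebraic.
[cite: Kleiman1968, §1.2 (A), (C)] -/
theorem algebraicClasses_top_eq_top (hX : IsSmoothProjective d X) : W.algebraicClasses X d = ⊤ :=
  eq_top_iff.2 ((W.lefschetzClasses_top_eq_top hX).ge.trans (W.lefschetzClasses_le_algebraicClasses hX d))

/-- **`E(r, s)` holds when `K · Aˢ(X) = H^{2s}(X)`**: a class orthogonal to all of `Aˢ(X)_ℚ` is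
orthogonal to its span `H^{2s}(X)`, hence zero by Poincaré duality. [cite: Kleiman1968, §3 (D(X)) and §1.2 (A)] -/
theorem homNum_of_algebraicClasses_eq_top_right (hX : IsSmoothProjective d X) {r s : ℕ}
    (h : 2 * r + 2 * s = 2 * d) (hs : W.algebraicClasses X s = ⊤) :
    ∀ x ∈ W.ratAlgebraicClasses X r, (∀ y ∈ W.ratAlgebraicClasses X s,
      W.cupPairing X d (2 * r) (2 * s) h x y = 0) → x = 0 := by
  intro x _ hx
  have hzero : W.cupPairing X d (2 * r) (2 * s) h x = 0 := by
    have hle : W.algebraicClasses X s ≤ LinearMap.ker (W.cupPairing X d (2 * r) (2 * s) h x) := by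
      unfold PreWeilCohomology.algebraicClasses
      rw [Submodule.span_le]
      intro y hy
      exact hx y (W.algebraicLattice_le_ratAlgebraicClasses X s hy)
    rw [hs, top_le_iff, LinearMap.ker_eq_top] at hle
    exact hle
  have hinj := (W.isPerfPair_cupPairing hX (2 * r) (2 * s) h).bijective_left.injective
  exact hinj (by rw [hzero, map_zero])

/-- **`E(0, d)`**: the Poincaré pairing `A⁰(X)_ℚ × Aᵈ(X)_ℚ → K` has trivial left kernel.
[cite: Kleiman1968, §3 (D(X)) and §1.2 (A), (C)] -/
theorem homNum_zero_top (hX : IsSmoothProjective d X) (h : 2 * 0 + 2 * d = 2 * d) :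
    ∀ x ∈ W.ratAlgebraicClasses X 0, (∀ y ∈ W.ratAlgebraicClasses X d,
      W.cupPairing X d (2 * 0) (2 * d) h x y = 0) → x = 0 :=
  W.homNum_of_algebraicClasses_eq_top_right hX h (W.algebraicClasses_top_eq_top hX)

/-- **`E(d, 0)`**: the Poincaré pairing `Aᵈ(X)_ℚ × A⁰(X)_ℚ → K` has trivial left kernel.
[cite: Kleiman1968, §3 (D(X)) and §1.2 (A), (C)] -/
theorem homNum_top_zero (hX : IsSmoothProjective d X) (h : 2 * d + 2 * 0 = 2 * d) :
    ∀ x ∈ W.ratAlgebraicClasses X d, (∀ y ∈ W.ratAlgebraicClasses X 0,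
      W.cupPairing X d (2 * d) (2 * 0) h x y = 0) → x = 0 :=
  W.homNum_of_algebraicClasses_eq_top_right hX h (W.algebraicClasses_zero_eq_top_univ hX)

/-- **The rank of the Poincaré pairing on `K·Aʳ × K·Aˢ` is `dim H^{2r}(X)` when both spans are
everything** (perfectness). [cite: Kleiman1968, §1.2 (A)] -/
theorem rank_eq_finrank_of_algebraicClasses_eq_top (hX : IsSmoothProjective d X) {r s : ℕ}
    (h : 2 * r + 2 * s = 2 * d) (hr : W.algebraicClasses X r = ⊤) (hs : W.algebraicClasses X s = ⊤) :
    Module.finrank K (LinearMap.range ((W.cupPairing X d (2 * r) (2 * s) h).domRestrict₁₂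
        (W.algebraicClasses X r) (W.algebraicClasses X s))) = Module.finrank K (W.obj X (2 * r)) := by
  haveI := W.finite_obj hX (2 * r)
  have hE : ∀ a ∈ W.algebraicClasses X r, (∀ a' ∈ W.algebraicClasses X s,
      W.cupPairing X d (2 * r) (2 * s) h a a' = 0) → a = 0 := by
    intro a _ ha
    have hzero : W.cupPairing X d (2 * r) (2 * s) h a = 0 := by
      ext y
      exact ha y (by rw [hs]; exact Submodule.mem_top)
    exact (W.isPerfPair_cupPairing hX (2 * r) (2 * s) h).bijective_left.injective
      (by rw [hzero, map_zero])
  rw [(InvariantPairing.finrank_range_domRestrict_eq_iff (W.cupPairing X d (2 * r) (2 * s) h)).mpr hE,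
    hr, finrank_top]

end WeilCohomology

/-! ## §2 The twisted Galois action is trivial on `H⁰` and `H^{2d}` -/

namespace GaloisWeilCohomology

variable {k : Type u} [Field k] {K : Type v} [Field K] [CharZero K]
  {χ : Field.absoluteGaloisGroup k →* Kˣ} (E : GaloisWeilCohomology k K χ)
variable {d : ℕ} {X : SchemeOver k}

/-- **`Γ_k` acts trivially on `H⁰(X)`**: `H⁰(X) = K · γ_X[X]` and algebraic classes are invariant.
[cite: Tate1994, §1] [cite: Kleiman1968, §1.2 (C)] -/
theorem ρTwist_zero_apply (hX : IsSmoothProjective d X) (g : Field.absoluteGaloisGroup k)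
    (x : E.obj X (2 * 0)) : E.ρTwist X (2 * 0) (0 : ℕ) g x = x := by
  have hx : x ∈ E.algebraicClasses X 0 := by
    rw [E.algebraicClasses_zero_eq_top_univ hX]; exact Submodule.mem_top
  exact E.algebraicClasses_le_invariants hX 0 hx g

/-- **The twisted action on the top degree is trivial**: `χ(g)^d g x = x` on `H^{2d}(X)` — the trace
`H^{2d}(X)(d) → K` is an invariant ISOMORPHISM (axioms `trace_ρ`, `bijective_trace`); for the
geometric Frobenius and `χ(F) = q⁻¹` this is Deligne's `F = q^d` on `H^{2d}`.
[cite: Deligne1974, (2.5)(c)] [cite: Tate1994, §1] -/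
theorem ρTwist_top_apply (hX : IsSmoothProjective d X) (g : Field.absoluteGaloisGroup k)
    (x : E.obj X (2 * d)) : E.ρTwist X (2 * d) (d : ℕ) g x = x := by
  apply (E.bijective_trace hX).1
  rw [ρTwist_apply]
  exact E.trace_ρ hX g x

/-- `Ker(χ(g)^0 g - 1) = H⁰(X)`. [cite: Tate1994, §1] -/
theorem ker_ρTwist_zero_sub_one_eq_top (hX : IsSmoothProjective d X)
    (g : Field.absoluteGaloisGroup k) :
    LinearMap.ker (E.ρTwist X (2 * 0) (0 : ℕ) g - 1) = ⊤ := by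
  refine eq_top_iff.2 fun x _ ↦ ?_
  rw [LinearMap.mem_ker, LinearMap.sub_apply, Module.End.one_apply, E.ρTwist_zero_apply hX, sub_self]

/-- `Ker(χ(g)^d g - 1) = H^{2d}(X)`. [cite: Deligne1974, (2.5)(c)] -/
theorem ker_ρTwist_top_sub_one_eq_top (hX : IsSmoothProjective d X)
    (g : Field.absoluteGaloisGroup k) :
    LinearMap.ker (E.ρTwist X (2 * d) (d : ℕ) g - 1) = ⊤ := by
  refine eq_top_iff.2 fun x _ ↦ ?_
  rw [LinearMap.mem_ker, LinearMap.sub_apply, Module.End.one_apply, E.ρTwist_top_apply hX, sub_self]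

/-- **`T_F(0)`: `K · A⁰(X) = Ker(χ(g)^0 g - 1)`** for every `g`. [cite: Tate1994, §1 and §2 Th. 2.9] -/
theorem algebraicClasses_zero_eq_ker (hX : IsSmoothProjective d X) (g : Field.absoluteGaloisGroup k) :
    E.algebraicClasses X 0 = LinearMap.ker (E.ρTwist X (2 * 0) (0 : ℕ) g - 1) := by
  rw [E.algebraicClasses_zero_eq_top_univ hX, E.ker_ρTwist_zero_sub_one_eq_top hX]

/-- **`T_F(d)`: `K · Aᵈ(X) = Ker(χ(g)^d g - 1)`** for every `g`. [cite: Tate1994, §1 and §2 Th. 2.9] -/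
theorem algebraicClasses_top_eq_ker (hX : IsSmoothProjective d X) (g : Field.absoluteGaloisGroup k) :
    E.algebraicClasses X d = LinearMap.ker (E.ρTwist X (2 * d) (d : ℕ) g - 1) := by
  rw [E.algebraicClasses_top_eq_top hX, E.ker_ρTwist_top_sub_one_eq_top hX]

/-- **The Tate conjecture holds in codimension `0`** (over any field): `K · A⁰(X) = (H⁰(X)(0))^{Γ_k}`.
[cite: Tate1994, §1 Conjecture T^0] -/
theorem tateConjectureFor_zero (hX : IsSmoothProjective d X) : E.TateConjectureFor X 0 :=
  E.tateConjectureFor_of_algebraicClasses_eq_ker hX 0 1 (E.algebraicClasses_zero_eq_ker hX 1)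

/-- **The Tate conjecture holds in codimension `d = dim X`** (over any field):
`K · Aᵈ(X) = (H^{2d}(X)(d))^{Γ_k}`. [cite: Tate1994, §1 Conjecture T^d] -/
theorem tateConjectureFor_top (hX : IsSmoothProjective d X) : E.TateConjectureFor X d :=
  E.tateConjectureFor_of_algebraicClasses_eq_ker hX d 1 (E.algebraicClasses_top_eq_ker hX 1)

variable [Finite k]

/-! ## §3 Over a finite field: Tate's theorem for `r = 0` and `r = d` unconditionally -/

/-- **Tate's `(a)` for `r = 0`**: `T_F(0) ∧ E(0, d)`. [cite: Tate1994, §2 Th. 2.9]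
[cite: Kahn2020, §6.14 (Conj. 6.52 holds for i = 0)] -/
theorem tate_a_zero (hX : IsSmoothProjective d X) (h : 2 * 0 + 2 * d = 2 * d) :
    E.algebraicClasses X 0 = LinearMap.ker (E.ρTwist X (2 * 0) (0 : ℕ) (geomFrob k) - 1) ∧
      ∀ x ∈ E.ratAlgebraicClasses X 0, (∀ y ∈ E.ratAlgebraicClasses X d,
        E.cupPairing X d (2 * 0) (2 * d) h x y = 0) → x = 0 :=
  ⟨E.algebraicClasses_zero_eq_ker hX _, E.homNum_zero_top hX h⟩

/-- **Tate's `(a)` for `r = d`**: `T_F(d) ∧ E(d, 0)`. [cite: Tate1994, §2 Th. 2.9]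
[cite: Kahn2020, §6.14 Conj. 6.52 and Th. 6.53] -/
theorem tate_a_top (hX : IsSmoothProjective d X) (h : 2 * d + 2 * 0 = 2 * d) :
    E.algebraicClasses X d = LinearMap.ker (E.ρTwist X (2 * d) (d : ℕ) (geomFrob k) - 1) ∧
      ∀ x ∈ E.ratAlgebraicClasses X d, (∀ y ∈ E.ratAlgebraicClasses X 0,
        E.cupPairing X d (2 * d) (2 * 0) h x y = 0) → x = 0 :=
  ⟨E.algebraicClasses_top_eq_ker hX _, E.homNum_top_zero hX h⟩

/-- **`S(0)` and `S(d)` hold**: `1` is a semisimple eigenvalue of the twisted Frobenius on `H⁰(X)`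
and on `H^{2d}(X)` (it is the identity there). [cite: Kahn2020, §6.14 Th. 6.53] -/
theorem ker_inf_range_eq_bot_zero_top (hX : IsSmoothProjective d X) :
    LinearMap.ker (E.ρTwist X (2 * 0) (0 : ℕ) (geomFrob k) - 1) ⊓
        LinearMap.range (E.ρTwist X (2 * 0) (0 : ℕ) (geomFrob k) - 1) = ⊥ ∧
      LinearMap.ker (E.ρTwist X (2 * d) (d : ℕ) (geomFrob k) - 1) ⊓
        LinearMap.range (E.ρTwist X (2 * d) (d : ℕ) (geomFrob k) - 1) = ⊥ := by
  have h : 2 * 0 + 2 * d = 2 * d := by omega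
  obtain ⟨hT, hE⟩ := E.tate_a_zero hX h
  obtain ⟨-, -, hS⟩ := (E.tate_a_iff_b hX (by omega) h).mp ⟨hT, hE⟩
  exact ⟨hS, (E.ker_inf_range_eq_bot_iff_of_add_eq hX (r := 0) (s := d) (by omega)).mp hS⟩

/-- **`dim H⁰(X)(0)_1 = 1`**: the generalized eigenspace of `1` of Frobenius on `H⁰(X)` is the whole
line. [cite: Kleiman1968, §1.2 (A)] [cite: Kahn2020, §6.14] -/
theorem finrank_maxGenEigenspace_zero_eq_one (hX : IsSmoothProjective d X) :
    Module.finrank K (Module.End.maxGenEigenspace (E.ρTwist X (2 * 0) (0 : ℕ) (geomFrob k)) 1) = 1 := by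
  haveI := E.finite_obj hX (2 * 0)
  have hS := (E.ker_inf_range_eq_bot_zero_top hX).1
  rw [(E.ker_inf_range_eq_bot_iff_maxGenEigenspace_eq (X := X) 0).mp hS,
    E.ker_ρTwist_zero_sub_one_eq_top hX, finrank_top]
  exact E.finrank_obj_zero hX

/-- **`dim H^{2d}(X)(d)_1 = 1`**: the generalized eigenspace of `1` of the twisted Frobenius
`χ(F)^d F` on `H^{2d}(X)` is the whole line (multiplicity one of the inverse root `q^d` of
`P_{2d}`). [cite: Deligne1974, (2.5)(c)] [cite: Kahn2020, §6.14] -/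
theorem finrank_maxGenEigenspace_top_eq_one (hX : IsSmoothProjective d X) :
    Module.finrank K (Module.End.maxGenEigenspace (E.ρTwist X (2 * d) (d : ℕ) (geomFrob k)) 1) = 1 := by
  haveI := E.finite_obj hX (2 * d)
  have hS := (E.ker_inf_range_eq_bot_zero_top hX).2
  rw [(E.ker_inf_range_eq_bot_iff_maxGenEigenspace_eq (X := X) d).mp hS,
    E.ker_ρTwist_top_sub_one_eq_top hX, finrank_top]
  exact E.finrank_obj_two_mul hX

omit [Finite k] in
/-- **`ρ_0 = 1`**: the rank of the numerical classes of codimension `0` (the rank of the Poincaré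
pairing on `K·A⁰ × K·Aᵈ`) is `1`. [cite: Kahn2020, §6.14 Conj. 6.52 (i = 0)] -/
theorem rank_zero_eq_one (hX : IsSmoothProjective d X) (h : 2 * 0 + 2 * d = 2 * d) :
    Module.finrank K (LinearMap.range ((E.cupPairing X d (2 * 0) (2 * d) h).domRestrict₁₂
        (E.algebraicClasses X 0) (E.algebraicClasses X d))) = 1 := by
  rw [E.rank_eq_finrank_of_algebraicClasses_eq_top hX h (E.algebraicClasses_zero_eq_top_univ hX)
    (E.algebraicClasses_top_eq_top hX)]
  exact E.finrank_obj_zero hX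

omit [Finite k] in
/-- **`ρ_d = 1`**: the rank of the numerical classes of codimension `d` is `1`.
[cite: Kahn2020, §6.14 Conj. 6.52] -/
theorem rank_top_eq_one (hX : IsSmoothProjective d X) (h : 2 * d + 2 * 0 = 2 * d) :
    Module.finrank K (LinearMap.range ((E.cupPairing X d (2 * d) (2 * 0) h).domRestrict₁₂
        (E.algebraicClasses X d) (E.algebraicClasses X 0))) = 1 := by
  rw [E.rank_eq_finrank_of_algebraicClasses_eq_top hX h (E.algebraicClasses_top_eq_top hX)
    (E.algebraicClasses_zero_eq_top_univ hX)]
  exact E.finrank_obj_two_mul hX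

/-- **Tate's `(c)` for `r = 0`: `ρ_0 = dim H⁰(X)(0)_1`** (both equal `1`). [cite: Tate1994, §2 Th. 2.9]
[cite: Kahn2020, §6.14 Conj. 6.52 (i = 0)] -/
theorem rank_zero_eq_finrank_maxGenEigenspace (hX : IsSmoothProjective d X)
    (h : 2 * 0 + 2 * d = 2 * d) :
    Module.finrank K (LinearMap.range ((E.cupPairing X d (2 * 0) (2 * d) h).domRestrict₁₂
        (E.algebraicClasses X 0) (E.algebraicClasses X d))) =
      Module.finrank K (Module.End.maxGenEigenspace (E.ρTwist X (2 * 0) (0 : ℕ) (geomFrob k)) 1) := by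
  rw [E.rank_zero_eq_one hX h, E.finrank_maxGenEigenspace_zero_eq_one hX]

/-- **Tate's `(c)` for `r = d`: `ρ_d = dim H^{2d}(X)(d)_1`** (both equal `1`). [cite: Tate1994, §2 Th. 2.9]
[cite: Kahn2020, §6.14 Conj. 6.52] -/
theorem rank_top_eq_finrank_maxGenEigenspace (hX : IsSmoothProjective d X)
    (h : 2 * d + 2 * 0 = 2 * d) :
    Module.finrank K (LinearMap.range ((E.cupPairing X d (2 * d) (2 * 0) h).domRestrict₁₂
        (E.algebraicClasses X d) (E.algebraicClasses X 0))) =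
      Module.finrank K (Module.End.maxGenEigenspace (E.ρTwist X (2 * d) (d : ℕ) (geomFrob k)) 1) := by
  rw [E.rank_top_eq_one hX h, E.finrank_maxGenEigenspace_top_eq_one hX]

/-- **`Z(X, t)` has a simple pole at `t = 1`** under the trace formula, `χ(φ) = q` and the Riemann
hypothesis for `X`: the case `i = 0` of Kahn's Conj. 6.52, which «holds for `i = 0` due to the
"Riemann hypothesis" part of the Weil conjectures» (the order `1 = ρ_0 = dim H⁰(X)(0)_1`).
[cite: Kahn2020, §6.14 Conj. 6.52] [cite: Deligne1974, Thm. (1.6)] -/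
theorem hasPoleOfOrderAt_zetaSeries_one (hE : E.HasLefschetzTraceFormula)
    (hχ : ((χ (arithFrob k) : Kˣ) : K) = Nat.card k) (hX : IsSmoothProjective d X)
    (hRH : E.WeilRiemannHypothesisFor X d) : HasPoleOfOrderAt (zetaSeries X) 1 1 := by
  have h := E.hasPoleOfOrderAt_zetaSeries hE hχ hX hRH (Nat.zero_le d)
  rwa [pow_zero, inv_one, E.finrank_maxGenEigenspace_zero_eq_one hX] at h

/-- **`Z(X, t)` has a simple pole at `t = q^{-d}`** under the trace formula, `χ(φ) = q` and the
Riemann hypothesis for `X` (`d = dim X`; the order `1 = ρ_d = dim H^{2d}(X)(d)_1`).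
[cite: Kahn2020, §6.14 Conj. 6.52] [cite: Deligne1974, (2.5)(c) and Thm. (1.6)] -/
theorem hasPoleOfOrderAt_zetaSeries_top (hE : E.HasLefschetzTraceFormula)
    (hχ : ((χ (arithFrob k) : Kˣ) : K) = Nat.card k) (hX : IsSmoothProjective d X)
    (hRH : E.WeilRiemannHypothesisFor X d) :
    HasPoleOfOrderAt (zetaSeries X) (((Nat.card k : ℚ) ^ d)⁻¹) 1 := by
  have h := E.hasPoleOfOrderAt_zetaSeries hE hχ hX hRH le_rfl
  rwa [E.finrank_maxGenEigenspace_top_eq_one hX] at h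

end GaloisWeilCohomology

end Literature.AlgebraicGeometry.Motives

end
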